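import Literature.MathematicalPhysics.QuantumFieldTheory.AbelianTorusCochainClusters
import HarnessLib

/-!
# Fluxes of torus `2`-cochains through the coordinate `2`-tori

Degree-two torus calculus on `Site d L = (ℤ/Lℤ)^d` with values in an additive commutative group
`A`, for the flux of a `2`-cochain `ω` through the coordinate `2`-torus of the plane `(μ, ν)`
passing through `x`,
`Φ_{μν}(ω)(x) = ∑_{s, t ∈ ℤ/Lℤ} ω (x + s eμ + t eν; μ, ν)` (written inline, no definition):
the coordinates of the 't Hooft class `[ω] ∈ H²(T^d; A)` of a closed `2`-cochain and the tools
making the monopole-corrected flux labelling of a lattice gauge field well defined.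

* `LatticeForm.sum_sum_td₁_eq_zero`: `Φ(td₁ θ) = 0` (exact cochains have no flux; Stokes on a
  closed surface).
* `LatticeForm.sum_sum_add_te_eq`: for a closed `ω` (`td₂ ω = 0` on all index triples) the flux
  does not depend on the transverse position, `Φ(ω)(x + e_ρ) = Φ(ω)(x)`; with
  `LatticeForm.eq_of_forall_add_te` (a function on the torus invariant under all unit steps is
  constant) it is a function of `ω` and the plane only.
* `LatticeForm.sum_sum_eq_zero_of_liftBox_shift`, `LatticeForm.sum_sum_eq_zero_of_diam`
  (**small closed cochains have no flux**, `d ≥ 3`): a closed alternating `2`-cochain supported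
  in a translate of a box away from the seam — in particular one whose support has torus
  sup-diameter `≤ R`, `2R + 3 ≤ L` — is exact (`exists_td₁_eq_of_liftBox`), hence has zero flux
  through every coordinate `2`-torus. (Independence of the corrected class from the local
  fillings; locality and translation covariance of the labelling.)
* `LatticeForm.sum_sum_ite_stack_eq`: the stack cochain of the plane `(μ, ν)` — value `z` on the
  plaquettes `(y; μ, ν)` with `y μ = y ν = 0`, zero elsewhere — has flux `z` through every
  `(μ, ν)` coordinate `2`-torus ('t Hooft's twist insertion carries the class `z`).
* `LatticeForm.td₂_ext_stack`, `LatticeForm.sum_sum_ext_stack`: the stack cochain of all planes at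
  once (`z_q` on the plaquettes `(x; q)` with `x_{q.1} = x_{q.2} = 0`, as in the clean-normalisation
  clause of the sector labelling) is closed and has flux `z_q` through the `q` coordinate `2`-tori;
  `IsAlt.add/neg`, `isAlt_zero`, `isAlt_sum`.
* `LatticeForm.sum_sum_eq_of_td₂_eq_of_near`: two alternating `2`-cochains with the same `td₂` on
  sorted triples, both supported within sup-distance `R` of a common site, `4R + 3 ≤ L`, have the
  same fluxes (the corrected class does not see the choice of local fillings).

Everything is proved; no definition and no named fact is introduced.

## References

* G. 't Hooft, *A property of electric and magnetic flux in non-abelian gauge theories*, Nucl.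
  Phys. B 153 (1979) 141–160, §§2–4 (flux sectors on the torus). [Thooft1979]
* M. P. Forsström, J. Lenells, F. Viklund, *Wilson loops in finite Abelian lattice gauge
  theories*, Ann. Inst. H. Poincaré Probab. Stat. 58 (2022), §2 (discrete exterior calculus on
  the torus, Lemma 2.2). [ForsstromLenellsViklund2022]
-/

set_option autoImplicit false

open Finset Function

namespace Literature.MathematicalPhysics.QuantumFieldTheory

namespace LatticeForm

variable {d L : ℕ} {A : Type*} [AddCommGroup A]

/-- One step along `eμ` inside the `(μ, ν)` `2`-torus through `x`. [folklore] -/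
theorem add_smul_te_add_te_fst (x : Site d L) (μ ν : Fin d) (s t : ZMod L) :
    x + s • te μ + t • te ν + te μ = x + (s + 1) • te μ + t • te ν := by
  rw [add_smul, one_smul]; abel

/-- One step along `eν` inside the `(μ, ν)` `2`-torus through `x`. [folklore] -/
theorem add_smul_te_add_te_snd (x : Site d L) (μ ν : Fin d) (s t : ZMod L) :
    x + s • te μ + t • te ν + te ν = x + s • te μ + (t + 1) • te ν := by
  rw [add_smul, one_smul]; abel

section Flux

variable [NeZero L]

/-- Re-indexing a sum over the `2`-torus by one step in the first direction. [folklore] -/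
theorem sum_sum_add_one_fst {β : Type*} [AddCommMonoid β] (F : ZMod L → ZMod L → β) :
    ∑ s : ZMod L, ∑ t : ZMod L, F (s + 1) t = ∑ s : ZMod L, ∑ t : ZMod L, F s t :=
  Fintype.sum_equiv (Equiv.addRight 1) _ _ fun _ => rfl

/-- Re-indexing a sum over the `2`-torus by one step in the second direction. [folklore] -/
theorem sum_sum_add_one_snd {β : Type*} [AddCommMonoid β] (F : ZMod L → ZMod L → β) :
    ∑ s : ZMod L, ∑ t : ZMod L, F s (t + 1) = ∑ s : ZMod L, ∑ t : ZMod L, F s t :=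
  Finset.sum_congr rfl fun _ _ => Fintype.sum_equiv (Equiv.addRight 1) _ _ fun _ => rfl

/-- **Exact cochains have no flux**: the flux of `td₁ θ` through the coordinate `2`-torus of the
plane `(μ, ν)` through `x` vanishes (the boundary line sums cancel on the closed surface).
[cite: ForsstromLenellsViklund2022, §2.3.2 (discrete Stokes, dd = 0 on the torus)] -/
theorem sum_sum_td₁_eq_zero (θ : Site d L → Fin d → A) (x : Site d L) (μ ν : Fin d) :
    ∑ s : ZMod L, ∑ t : ZMod L, td₁ θ (x + s • te μ + t • te ν) μ ν = 0 := by
  simp only [td₁, add_smul_te_add_te_fst, add_smul_te_add_te_snd, Finset.sum_sub_distrib,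
    Finset.sum_add_distrib]
  rw [sum_sum_add_one_fst (fun s t => θ (x + s • te μ + t • te ν) ν),
    sum_sum_add_one_snd (fun s t => θ (x + s • te μ + t • te ν) μ)]
  abel

/-- **The flux of a closed cochain does not depend on the transverse position.** If
`td₂ ω = 0` on all index triples, the flux of `ω` through the `(μ, ν)` coordinate `2`-torus
through `x + e_ρ` equals the one through `x`, for every direction `ρ` (sum `td₂ ω (y; ρ, μ, ν) = 0`
over the `2`-torus: the `ρν`- and `ρμ`-terms telescope). [cite: ForsstromLenellsViklund2022, §2.3.2 (discrete Stokes)] -/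
theorem sum_sum_add_te_eq {ω : Site d L → Fin d → Fin d → A}
    (hcl : ∀ y i j k, td₂ ω y i j k = 0) (x : Site d L) (ρ μ ν : Fin d) :
    ∑ s : ZMod L, ∑ t : ZMod L, ω (x + te ρ + s • te μ + t • te ν) μ ν =
      ∑ s : ZMod L, ∑ t : ZMod L, ω (x + s • te μ + t • te ν) μ ν := by
  have key : ∀ s t : ZMod L,
      ω (x + te ρ + s • te μ + t • te ν) μ ν - ω (x + s • te μ + t • te ν) μ ν =
        (ω (x + (s + 1) • te μ + t • te ν) ρ ν - ω (x + s • te μ + t • te ν) ρ ν) -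
          (ω (x + s • te μ + (t + 1) • te ν) ρ μ - ω (x + s • te μ + t • te ν) ρ μ) := by
    intro s t
    have h := hcl (x + s • te μ + t • te ν) ρ μ ν
    have e1 : x + s • te μ + t • te ν + te ρ = x + te ρ + s • te μ + t • te ν := by abel
    simp only [td₂, e1, add_smul_te_add_te_fst, add_smul_te_add_te_snd] at h
    rw [← sub_eq_zero, ← h]
    abel
  rw [← sub_eq_zero, ← Finset.sum_sub_distrib]
  simp_rw [← Finset.sum_sub_distrib, key]
  simp only [Finset.sum_sub_distrib]
  rw [sum_sum_add_one_fst (fun s t => ω (x + s • te μ + t • te ν) ρ ν),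
    sum_sum_add_one_snd (fun s t => ω (x + s • te μ + t • te ν) ρ μ)]
  abel

omit [AddCommGroup A] in
/-- **A function on the torus invariant under all unit steps is constant** (every site is a sum of
unit steps: `v = ∑_ρ val(v_ρ) • e_ρ`). [folklore] -/
theorem eq_of_forall_add_te {β : Sort*} {f : Site d L → β} (hf : ∀ x ρ, f (x + te ρ) = f x)
    (x y : Site d L) : f x = f y := by
  -- invariance under `n` unit steps in one direction
  have hstep : ∀ (ρ : Fin d) (n : ℕ) (x : Site d L), f (x + n • te ρ) = f x := by
    intro ρ n
    induction n with
    | zero => intro x; simp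
    | succ n ih => intro x; rw [succ_nsmul, ← add_assoc, hf, ih]
  -- invariance under a sum of such steps
  have hsum : ∀ (s : Finset (Fin d)) (n : Fin d → ℕ) (x : Site d L),
      f (x + ∑ ρ ∈ s, n ρ • te ρ) = f x := by
    classical
    intro s n
    induction s using Finset.induction_on with
    | empty => intro x; simp
    | insert a s ha ih => intro x; rw [Finset.sum_insert ha, add_comm (n a • te a), ← add_assoc, hstep, ih]
  -- every `v` is such a sum
  have hv : ∀ v : Site d L, v = ∑ ρ, (v ρ).val • te ρ := by
    intro v
    funext k
    rw [Finset.sum_apply, Finset.sum_eq_single k]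
    · simp [te]
    · intro ρ _ hρ; simp [te, Pi.single_eq_of_ne (Ne.symm hρ)]
    · intro h; exact absurd (Finset.mem_univ k) h
  have := hsum Finset.univ (fun ρ => (( y - x) ρ).val) x
  rw [← hv (y - x), add_sub_cancel] at this
  exact this.symm

/-- **Small closed `2`-cochains have no flux (box form).** On `(ℤ/Lℤ)^d`, `d ≥ 3`, an alternating
closed `2`-cochain whose non-zero plaquettes have base points, translated by `-v`, with canonical
coordinates in a box `[a, b]`, `1 ≤ a`, `b ≤ L - 2`, is exact (`exists_td₁_eq_of_liftBox` after a
translation), hence has zero flux through every coordinate `2`-torus.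
[cite: ForsstromLenellsViklund2022, §2 (Lemma 2.2, the Poincaré lemma)] -/
theorem sum_sum_eq_zero_of_liftBox_shift (hd : 3 ≤ d) {ω : Site d L → Fin d → Fin d → A}
    {a b : Literature.Probability.LatticeModels.Site d} (v : Site d L) (hω : IsAlt ω)
    (hcl : ∀ y i j k, td₂ ω y i j k = 0) (ha : ∀ n, 1 ≤ a n) (hb : ∀ n, b n ≤ (L : ℤ) - 2)
    (hsupp : ∀ y i j, ω y i j ≠ 0 → torusSiteLift (y - v) ∈ Set.Icc a b) (x : Site d L)
    (μ ν : Fin d) :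
    ∑ s : ZMod L, ∑ t : ZMod L, ω (x + s • te μ + t • te ν) μ ν = 0 := by
  have hbox : LiftBox (shiftCochain₂ v ω) a b :=
    ⟨ha, hb, fun y i j h => by simpa using hsupp (y + v) i j h⟩
  obtain ⟨θ, hθ, -⟩ := exists_td₁_eq_of_liftBox hd (hω.shiftCochain₂ v)
    (fun y i j k => by rw [td₂_shiftCochain₂]; exact hcl _ i j k) hbox
  have hω' : ω = td₁ (shiftCochain₁ (-v) θ) := by
    rw [td₁_shiftCochain₁, hθ, shiftCochain₂_neg_shiftCochain₂]
  rw [hω']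
  exact sum_sum_td₁_eq_zero _ x μ ν

/-- **Small closed `2`-cochains have no flux (diameter form).** On `(ℤ/Lℤ)^d`, `d ≥ 3`, an
alternating closed `2`-cochain any two of whose non-zero plaquettes have base points within torus
sup-distance `R` (`|valMinAbs|` coordinatewise), `2R + 3 ≤ L`, has zero flux through every
coordinate `2`-torus. (Translate a non-zero plaquette to canonical coordinates `R + 1` and apply
the box form with `[a, b] = [1, 2R + 1]`.) This is what makes the monopole-corrected class
independent of the choice of the local fillings and local in the gauge field.
[cite: ForsstromLenellsViklund2022, §2 (Lemma 2.2, the Poincaré lemma)] -/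
theorem sum_sum_eq_zero_of_diam (hd : 3 ≤ d) {ω : Site d L → Fin d → Fin d → A} (R : ℕ)
    (hL : 2 * R + 3 ≤ L) (hω : IsAlt ω) (hcl : ∀ y i j k, td₂ ω y i j k = 0)
    (hdiam : ∀ (y : Site d L) (i j : Fin d) (y' : Site d L) (i' j' : Fin d), ω y i j ≠ 0 →
      ω y' i' j' ≠ 0 → ∀ n, ((y n - y' n).valMinAbs).natAbs ≤ R)
    (x : Site d L) (μ ν : Fin d) :
    ∑ s : ZMod L, ∑ t : ZMod L, ω (x + s • te μ + t • te ν) μ ν = 0 := by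
  by_cases hne : ∃ (y₀ : Site d L) (i₀ j₀ : Fin d), ω y₀ i₀ j₀ ≠ 0
  swap
  · push Not at hne
    simp [hne]
  obtain ⟨y₀, i₀, j₀, h₀⟩ := hne
  obtain ⟨c, hc⟩ : ∃ c : ℤ, c = R + 1 := ⟨_, rfl⟩
  refine sum_sum_eq_zero_of_liftBox_shift hd (a := fun _ => (1 : ℤ)) (b := fun _ => (2 * R + 1 : ℤ))
    (fun n => y₀ n - (c : ZMod L)) hω hcl (fun _ => le_rfl) (fun _ => by omega)
    (fun y i j h => ?_) x μ ν
  have hR := hdiam y i j y₀ i₀ j₀ h h₀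
  refine ⟨fun n => ?_, fun n => ?_⟩
  · show (1 : ℤ) ≤ torusSiteLift _ n
    rw [torusSiteLift_sub_eq_valMinAbs_add y y₀ c (R := R) (by omega) (by omega) n (hR n)]
    have := hR n; omega
  · show torusSiteLift _ n ≤ 2 * R + 1
    rw [torusSiteLift_sub_eq_valMinAbs_add y y₀ c (R := R) (by omega) (by omega) n (hR n)]
    have := hR n; omega

/-- **The stack cochain carries its twist.** For `μ ≠ ν`, the `2`-cochain of the plane `(μ, ν)`
with value `z` on the plaquettes `(y; μ, ν)` with `y μ = y ν = 0` and `0` elsewhere ('t Hooft's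
twist insertion along the codimension-two stack `{y μ = y ν = 0}`) has flux `z` through the
`(μ, ν)` coordinate `2`-torus through every `x`: exactly one plaquette of that torus lies on the
stack. [cite: Thooft1979, §2 (twisted boundary conditions and flux)] -/
theorem sum_sum_ite_stack_eq (x : Site d L) {μ ν : Fin d} (hμν : μ ≠ ν) (z : A) :
    ∑ s : ZMod L, ∑ t : ZMod L,
      (if (x + s • te μ + t • te ν : Site d L) μ = 0 ∧ (x + s • te μ + t • te ν : Site d L) ν = 0
        then z else 0) = z := by
  classical
  have hμ : ∀ s t : ZMod L, (x + s • te μ + t • te ν : Site d L) μ = x μ + s := by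
    intro s t; simp [Pi.single_eq_of_ne hμν]
  have hν : ∀ s t : ZMod L, (x + s • te μ + t • te ν : Site d L) ν = x ν + t := by
    intro s t; simp [Pi.single_eq_of_ne (Ne.symm hμν)]
  simp_rw [hμ, hν]
  rw [Finset.sum_eq_single (-x μ)]
  · rw [Finset.sum_eq_single (-x ν)]
    · simp
    · intro t _ ht
      rw [if_neg]
      rintro ⟨-, h⟩
      exact ht (by linear_combination h)
    · intro h; exact absurd (Finset.mem_univ _) h
  · intro s _ hs
    refine Finset.sum_eq_zero fun t _ => ?_
    rw [if_neg]
    rintro ⟨h, -⟩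
    exact hs (by linear_combination h)
  · intro h; exact absurd (Finset.mem_univ _) h

end Flux

/-- `td₂ (ω - ω') = td₂ ω - td₂ ω'`. [folklore] -/
theorem td₂_sub (ω ω' : Site d L → Fin d → Fin d → A) : td₂ (ω - ω') = td₂ ω - td₂ ω' := by
  funext x i j k; simp only [td₂, Pi.sub_apply]; abel

/-- Differences of alternating cochains are alternating. [folklore] -/
theorem IsAlt.sub {ω ω' : Site d L → Fin d → Fin d → A} (h : IsAlt ω) (h' : IsAlt ω') :
    IsAlt (ω - ω') :=
  ⟨fun x i j => by simp only [Pi.sub_apply, h.1 x i j, h'.1 x i j]; abel,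
    fun x i => by simp only [Pi.sub_apply, h.2 x i, h'.2 x i, sub_zero]⟩

/-- **Two local primitives of the same current have the same fluxes.** On `(ℤ/Lℤ)^d`, `d ≥ 3`,
let `ω₁, ω₂` be alternating `2`-cochains with `td₂ ω₁ = td₂ ω₂` on the sorted index triples, both
supported on plaquettes whose base points are within torus sup-distance `R` of a common site `y₀`,
`4R + 3 ≤ L`. Then `ω₁` and `ω₂` have the same flux through every coordinate `2`-torus
(`ω₁ - ω₂` is alternating, closed — `td₂_eq_zero_of_sorted` — and of sup-diameter `≤ 2R`:
`sum_sum_eq_zero_of_diam`). This is the form in which the monopole-corrected class does not see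
the choice of the local fillings (two fillings of one cluster; a filling and the translate /
axis-permute of a filling). [cite: ForsstromLenellsViklund2022, §2 (Lemma 2.2, the Poincaré lemma)] -/
theorem sum_sum_eq_of_td₂_eq_of_near [NeZero L] (hd : 3 ≤ d)
    {ω₁ ω₂ : Site d L → Fin d → Fin d → A} (y₀ : Site d L) (R : ℕ) (hL : 4 * R + 3 ≤ L)
    (h₁ : IsAlt ω₁) (h₂ : IsAlt ω₂)
    (htd : ∀ y (i j k : Fin d), i < j → j < k → td₂ ω₁ y i j k = td₂ ω₂ y i j k)
    (hs₁ : ∀ y i j, ω₁ y i j ≠ 0 → ∀ n, ((y n - y₀ n).valMinAbs).natAbs ≤ R)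
    (hs₂ : ∀ y i j, ω₂ y i j ≠ 0 → ∀ n, ((y n - y₀ n).valMinAbs).natAbs ≤ R)
    (x : Site d L) (μ ν : Fin d) :
    ∑ s : ZMod L, ∑ t : ZMod L, ω₁ (x + s • te μ + t • te ν) μ ν =
      ∑ s : ZMod L, ∑ t : ZMod L, ω₂ (x + s • te μ + t • te ν) μ ν := by
  -- `ω₁ - ω₂` is closed on all index triples
  have hcl : ∀ y i j k, td₂ (ω₁ - ω₂) y i j k = 0 :=
    td₂_eq_zero_of_sorted (h₁.sub h₂) fun y i j k hij hjk => by
      rw [td₂_sub, Pi.sub_apply, Pi.sub_apply, Pi.sub_apply, Pi.sub_apply, htd y i j k hij hjk,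
        sub_self]
  -- and supported within distance `R` of `y₀`, hence of sup-diameter `≤ 2R`
  have hnear : ∀ y i j, (ω₁ - ω₂) y i j ≠ 0 → ∀ n, ((y n - y₀ n).valMinAbs).natAbs ≤ R := by
    intro y i j h n
    by_cases hz : ω₁ y i j = 0
    · have hz' : ω₂ y i j ≠ 0 := by
        intro hz'; apply h; simp [hz, hz']
      exact hs₂ y i j hz' n
    · exact hs₁ y i j hz n
  have hdiam : ∀ (y : Site d L) (i j : Fin d) (y' : Site d L) (i' j' : Fin d), (ω₁ - ω₂) y i j ≠ 0 →
      (ω₁ - ω₂) y' i' j' ≠ 0 → ∀ n, ((y n - y' n).valMinAbs).natAbs ≤ 2 * R := by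
    intro y i j y' i' j' h h' n
    have ha := hnear y i j h n
    have hb := hnear y' i' j' h' n
    have hsplit : y n - y' n = (y n - y₀ n) + -(y' n - y₀ n) := by ring
    rw [hsplit]
    refine (ZMod.natAbs_valMinAbs_add_le _ _).trans ((Int.natAbs_add_le _ _).trans ?_)
    rw [ZMod.natAbs_valMinAbs_neg]
    omega
  have key := sum_sum_eq_zero_of_diam hd (2 * R) (by omega) (h₁.sub h₂) hcl hdiam x μ ν
  simpa only [Pi.sub_apply, Finset.sum_sub_distrib, sub_eq_zero] using key

/-- Sums of alternating cochains are alternating. [folklore] -/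
theorem IsAlt.add {X : Type*} {ω ω' : X → Fin d → Fin d → A} (h : IsAlt ω) (h' : IsAlt ω') :
    IsAlt (ω + ω') :=
  ⟨fun x i j => by simp only [Pi.add_apply, h.1 x i j, h'.1 x i j]; abel,
    fun x i => by simp only [Pi.add_apply, h.2 x i, h'.2 x i, add_zero]⟩

/-- Negatives of alternating cochains are alternating. [folklore] -/
theorem IsAlt.neg {X : Type*} {ω : X → Fin d → Fin d → A} (h : IsAlt ω) : IsAlt (-ω) :=
  ⟨fun x i j => by simp only [Pi.neg_apply, h.1 x i j],
    fun x i => by simp only [Pi.neg_apply, h.2 x i, neg_zero]⟩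

/-- The zero cochain is alternating. [folklore] -/
theorem isAlt_zero {X : Type*} : IsAlt (0 : X → Fin d → Fin d → A) :=
  ⟨fun _ _ _ => by simp, fun _ _ => rfl⟩

/-- Finite sums of alternating cochains are alternating. [folklore] -/
theorem isAlt_sum {X ι : Type*} (s : Finset ι) {ω : ι → X → Fin d → Fin d → A}
    (h : ∀ c ∈ s, IsAlt (ω c)) : IsAlt (∑ c ∈ s, ω c) := by
  classical
  induction s using Finset.induction_on with
  | empty => simpa using (isAlt_zero : IsAlt (0 : X → Fin d → Fin d → A))
  | insert a s ha ih =>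
    rw [Finset.sum_insert ha]
    exact (h a (Finset.mem_insert_self a s)).add (ih fun c hc => h c (Finset.mem_insert_of_mem hc))

/-- **'t Hooft's stack cochain is closed.** The alternating extension of the plaquette function
inserting `z_q` on the plaquettes `(x; q)`, `q = (μ < ν)`, with `x μ = x ν = 0` (all planes `q` at
once) is `td₂`-closed: on a sorted `3`-cell `(y; i < j < k)` the two `(j, k)`-faces `y`, `y + eᵢ`
have the same `j`-th and `k`-th coordinates, etc. (On clean configurations the cell labels are
this cochain plus a coboundary, so the monopole current vanishes.)
[cite: Thooft1979, §2 (twisted boundary conditions and flux)] -/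
theorem td₂_ext_stack (z : {p : Fin d × Fin d // p.1 < p.2} → A) (y : Site d L) (i j k : Fin d) :
    td₂ (ext fun p : Plaquette d L => if p.1 p.2.1.1 = 0 ∧ p.1 p.2.1.2 = 0 then z p.2 else 0)
      y i j k = 0 := by
  classical
  refine td₂_eq_zero_of_sorted (isAlt_ext _) (fun y i j k hij hjk => ?_) y i j k
  rw [td₂_ext_sorted _ y hij hjk]
  have hstep : ∀ (a l : Fin d), l ≠ a → (y + te a : Site d L) l = y l := fun a l hl => by
    simp [Pi.single_eq_of_ne hl]
  simp only [hstep i j hij.ne', hstep i k (hij.trans hjk).ne', hstep j i hij.ne,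
    hstep j k hjk.ne', hstep k i (hij.trans hjk).ne, hstep k j hjk.ne, sub_self, add_zero]

/-- **'t Hooft's stack cochain carries the class `z`.** For `μ < ν`, the flux of the stack
cochain of `z` through the `(μ, ν)` coordinate `2`-torus through any `x` is `z (μ, ν)`
(`sum_sum_ite_stack_eq`). [cite: Thooft1979, §2 (twisted boundary conditions and flux)] -/
theorem sum_sum_ext_stack [NeZero L] (z : {p : Fin d × Fin d // p.1 < p.2} → A) (x : Site d L)
    {μ ν : Fin d} (hμν : μ < ν) :
    ∑ s : ZMod L, ∑ t : ZMod L,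
      ext (fun p : Plaquette d L => if p.1 p.2.1.1 = 0 ∧ p.1 p.2.1.2 = 0 then z p.2 else 0)
        (x + s • te μ + t • te ν) μ ν = z ⟨(μ, ν), hμν⟩ := by
  simp only [ext_apply_of_lt _ _ hμν]
  exact sum_sum_ite_stack_eq x hμν.ne (z ⟨(μ, ν), hμν⟩)

end LatticeForm

end Literature.MathematicalPhysics.QuantumFieldTheory
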